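import Literature.NumberTheory.GaloisRepresentations.ContinuousShapiroOpenCoinducedRightAction
import Literature.NumberTheory.GaloisRepresentations.CorestrictionConjInvariant
import HarnessLib

/-!
# The Shapiro isomorphism `Hⁿ(G, Maps(G ⧸ W, M)) ≃ Hⁿ(W, M)` carries the RIGHT-TRANSLATION action of
# `Δ = G ⧸ W` to the CONJUGATION action on `Hⁿ(W, M)` (Serre, *Corps locaux* VII §5; NSW (1.6.4)–(1.6.5))

Topic `NumberTheory/GaloisRepresentations` (continuous cochain cohomology); namespace
`Literature.NumberTheory.GaloisRepresentations` (dot notation under `ContinuousRep`).  THEOREMS ONLY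
(no definition, no named fact, no `sorry`, no instance; D-0026).

For a profinite group `G`, an OPEN NORMAL subgroup `W`, `Δ = G ⧸ W`, and a discrete `G`-module `M`
(`ρ : ContinuousRep G ℤ M`), the tree holds: the permutation model `Maps(G ⧸ W, M)` (`ρ.coindOpen W hW`)
with its right translations `R_c`, `(R_c φ)(y) = φ(y c)` and the resulting `ℤ[Δ]`-module structure
`ρ.coindOpenHRep W hW n : c ↦ Hⁿ(R_c)` on `Hⁿ(G, Maps(G ⧸ W, M))` (-w7 g9,
`ContinuousShapiroOpenCoinducedRightAction`); the Shapiro isomorphism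
`ρ.shapiroOpenAddEquiv W hW n : Hⁿ(G, Maps(G ⧸ W, M)) ≃+ Hⁿ(W, Res_W M)` (`ContinuousShapiroOpenCoinduced`,
through Serre's model `M_G^W(Res_W M)` and `shapiroAddEquiv`); and the conjugation action
`conjMap ρ.toTopRep W g n` of `g ∈ G` on `Hⁿ(W, Res_W M)` (`ContinuousCorestriction`; on cocycles
`(g·φ)(x) = g φ(g⁻¹ x g)`), with `g · sh(y) = sh(Hⁿ(T_g) y)` for Serre's twist `(T_g F)(x) = g F(g⁻¹ x)`
(`CorestrictionConjInvariant.conjMap_shMap_one/_two`).  This file proves the dictionary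

  `sh (Hⁿ(R_{gW}) x) = g · sh (x)`     (`n = 1, 2`; `sh = shapiroOpenAddEquiv`)

(Serre, *Corps locaux* VII §5: the `G/H`-module structure of `Hq(H, A)` "provient, par l'isomorphisme
de Shapiro, de la structure de `G/H`-module de `M_G^H(A) = A ⊗ ℤ[G/H]`"; NSW (1.6.5)): the
identification `Maps(G ⧸ W, M) ≃ M_G^W(Res_W M)`, `φ ↦ (x ↦ x • φ(x⁻¹ W))` (`coindOpenEquiv`)
carries `R_{gW}` to `T_g` (`coindOpenEquiv_coindOpenRTrans`), the transport of cohomology along it is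
natural (`continuousCohomologyAddEquiv_map`), and `conjMap_shMap_one/_two` finishes.

Lane «TATE-EPC-TC» of cell `bsd-eis` (crux `GoodLatticeBDPValue`, stmt-BirchSwinnertonDyer-19032), piece
(θ-i)-top, continuous half: with `G = U ≤ G_{K,S}` open, `W = Gal(K_S/E)`, `M = E_S`, this turns the
right-action `Δ`-module `H²(U, Maps(Δ, E_S))` of bricks B8-arith/(E) into `H²(W, E_S)` with the
conjugation action, on which the local invariants are read ((θ-ii), -w3 g16).  HONEST FRAMING:
homological algebra of profinite groups only; no arithmetic statement is proved here.

## References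
* J.-P. Serre, *Corps locaux* / *Local Fields* (1979), VII §5 (Prop. 3 and the remark on the
  `G/H`-module structure of `Hq(H, A)` via Shapiro). [SerreLocalFields1979]
* J. Neukirch, A. Schmidt, K. Wingberg, *Cohomology of Number Fields*, 2nd ed. (2008), I §6
  Prop. (1.6.4)–(1.6.5) (Shapiro's lemma and the compatibility with conjugation). [NeukirchSchmidtWingberg2008]
* J.-P. Serre, *Cohomologie galoisienne* (1994), I §2.5. [SerreGaloisCohomology1997]
-/

noncomputable section

open CategoryTheory Function
open scoped Topology

universe u

namespace Literature.NumberTheory.GaloisRepresentations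

open _root_.TopRep _root_.ContRepresentation _root_.ContinuousCohomology

namespace ContinuousRep

variable {G : Type u} [Group G] [TopologicalSpace G] [IsTopologicalGroup G] [CompactSpace G]
variable {M : Type u} [AddCommGroup M] [TopologicalSpace M] [DiscreteTopology M]
variable (ρ : ContinuousRep G ℤ M) (W : Subgroup G) [hWn : W.Normal] (hW : IsOpen (W : Set G))

/-! ### §1. Module level: `coindOpenEquiv` carries `R_{gW}` to Serre's twist `T_g` -/

/-- **`coindOpenEquiv (R_{gW} φ) = T_g (coindOpenEquiv φ)`**: both are `x ↦ x • φ(x⁻¹ g W)`.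
[cite: SerreLocalFields1979, VII §5] [cite: NeukirchSchmidtWingberg2008, I §6 Prop. (1.6.5)] -/
theorem coindOpenEquiv_coindOpenRTrans (g : G) (φ : G ⧸ W → M) :
    ρ.coindOpenEquiv W hW ((ρ.coindOpenRTrans W hW (g : G ⧸ W)).hom φ) =
      (coindTwistHom W ρ g).hom (ρ.coindOpenEquiv W hW φ) := by
  apply Subtype.ext
  ext x
  rw [coindOpenEquiv_apply, coindOpenEquiv_apply, toCoindModule_apply, coindOpenRTrans_apply,
    coindTwistHom_coe_apply, toCoindModule_apply, ← Module.End.mul_apply, ← map_mul,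
    mul_inv_cancel_left, mul_inv_rev, inv_inv, QuotientGroup.mk_mul]

/-! ### §2. Cohomology: `sh ∘ Hⁿ(R_{gW}) = (g ·) ∘ sh` -/

section Shapiro

variable [T2Space G] [TotallyDisconnectedSpace G]

omit [T2Space G] [TotallyDisconnectedSpace G] in
/-- The transport `Hⁿ(G, Maps(G ⧸ W, M)) ≃+ Hⁿ(G, M_G^W(Res_W M))` along `coindOpenEquiv` carries
`Hⁿ(R_{gW})` to `Hⁿ(T_g)` (naturality of `continuousCohomologyAddEquiv`).
[cite: NeukirchSchmidtWingberg2008, I §6 Prop. (1.6.5)] -/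
theorem continuousCohomologyAddEquiv_coindOpenHRep (n : ℕ) (g : G)
    (x : continuousCohomology n (ρ.coindOpen W hW).toTopRep) :
    haveI : IsClosed (W : Set G) := Subgroup.isClosed_of_isOpen W hW
    continuousCohomologyAddEquiv (X := (ρ.coindOpen W hW).toTopRep)
        (Y := (coindRep (ρ.restrict (subgroupIncl W))).toTopRep)
        (ρ.coindOpenEquiv W hW : (G ⧸ W → M) ≃ₜ+ _) (fun g φ => ρ.coindOpenEquiv_map W hW g φ) n
        (ρ.coindOpenHRep W hW n (g : G ⧸ W) x) =
      (cohomologyMap (coindTwistHom W ρ g) n).hom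
        (continuousCohomologyAddEquiv (X := (ρ.coindOpen W hW).toTopRep)
          (Y := (coindRep (ρ.restrict (subgroupIncl W))).toTopRep)
          (ρ.coindOpenEquiv W hW : (G ⧸ W → M) ≃ₜ+ _) (fun g φ => ρ.coindOpenEquiv_map W hW g φ) n x) := by
  haveI : IsClosed (W : Set G) := Subgroup.isClosed_of_isOpen W hW
  rw [coindOpenHRep_apply]
  exact continuousCohomologyAddEquiv_map
    (X := (ρ.coindOpen W hW).toTopRep) (X' := (coindRep (ρ.restrict (subgroupIncl W))).toTopRep)
    (Y := (ρ.coindOpen W hW).toTopRep) (Y' := (coindRep (ρ.restrict (subgroupIncl W))).toTopRep)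
    (ρ.coindOpenEquiv W hW : (G ⧸ W → M) ≃ₜ+ _) (fun g φ => ρ.coindOpenEquiv_map W hW g φ)
    (ρ.coindOpenEquiv W hW : (G ⧸ W → M) ≃ₜ+ _) (fun g φ => ρ.coindOpenEquiv_map W hW g φ)
    (ContinuousMonoidHom.id G) (resIdHom (ρ.coindOpenRTrans W hW (g : G ⧸ W)))
    (resIdHom (coindTwistHom W ρ g)) (fun φ => ρ.coindOpenEquiv_coindOpenRTrans W hW g φ) n x

/-- **`sh (H¹(R_{gW}) x) = g · sh x` on `H¹`**: the Shapiro isomorphism `shapiroOpenAddEquiv` carries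
the right-translation action of `Δ = G ⧸ W` on `H¹(G, Maps(G ⧸ W, M))` (`coindOpenHRep`) to the
conjugation action `conjMap` on `H¹(W, Res_W M)`. [cite: SerreLocalFields1979, VII §5]
[cite: NeukirchSchmidtWingberg2008, I §6 Prop. (1.6.5)] -/
theorem shapiroOpenAddEquiv_coindOpenHRep_one (g : G)
    (x : continuousCohomology 1 (ρ.coindOpen W hW).toTopRep) :
    haveI : IsClosed (W : Set G) := Subgroup.isClosed_of_isOpen W hW
    ρ.shapiroOpenAddEquiv W hW 1 (ρ.coindOpenHRep W hW 1 (g : G ⧸ W) x) =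
      conjMap ρ.toTopRep W g 1 (ρ.shapiroOpenAddEquiv W hW 1 x) := by
  haveI : IsClosed (W : Set G) := Subgroup.isClosed_of_isOpen W hW
  unfold shapiroOpenAddEquiv
  rw [AddEquiv.trans_apply, AddEquiv.trans_apply, continuousCohomologyAddEquiv_coindOpenHRep,
    shapiroAddEquiv_apply, shapiroAddEquiv_apply]
  exact (conjMap_shMap_one W ρ g _).symm

/-- **`sh (H²(R_{gW}) x) = g · sh x` on `H²`**: the Shapiro isomorphism `shapiroOpenAddEquiv` carries
the right-translation action of `Δ = G ⧸ W` on `H²(G, Maps(G ⧸ W, M))` (`coindOpenHRep`) to the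
conjugation action `conjMap` on `H²(W, Res_W M)`. [cite: SerreLocalFields1979, VII §5]
[cite: NeukirchSchmidtWingberg2008, I §6 Prop. (1.6.5)] -/
theorem shapiroOpenAddEquiv_coindOpenHRep_two (g : G)
    (x : continuousCohomology 2 (ρ.coindOpen W hW).toTopRep) :
    haveI : IsClosed (W : Set G) := Subgroup.isClosed_of_isOpen W hW
    ρ.shapiroOpenAddEquiv W hW 2 (ρ.coindOpenHRep W hW 2 (g : G ⧸ W) x) =
      conjMap ρ.toTopRep W g 2 (ρ.shapiroOpenAddEquiv W hW 2 x) := by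
  haveI : IsClosed (W : Set G) := Subgroup.isClosed_of_isOpen W hW
  unfold shapiroOpenAddEquiv
  rw [AddEquiv.trans_apply, AddEquiv.trans_apply, continuousCohomologyAddEquiv_coindOpenHRep,
    shapiroAddEquiv_apply, shapiroAddEquiv_apply]
  exact (conjMap_shMap_two W ρ g _).symm

/-- Elements of `W` act trivially: `sh (H²(R_w) x) = sh x` for `w ∈ W` — consistent with
`R_{wW} = R_1 = id`. (A sanity restatement of `conjMap_eq_self_of_mem_two` through the dictionary.)
[cite: SerreLocalFields1979, VII §5 Prop. 3] -/
theorem conjMap_shapiroOpenAddEquiv_eq_self_of_mem_two {w : G} (hw : w ∈ W)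
    (x : continuousCohomology 2 (ρ.coindOpen W hW).toTopRep) :
    haveI : IsClosed (W : Set G) := Subgroup.isClosed_of_isOpen W hW
    conjMap ρ.toTopRep W w 2 (ρ.shapiroOpenAddEquiv W hW 2 x) = ρ.shapiroOpenAddEquiv W hW 2 x := by
  haveI : IsClosed (W : Set G) := Subgroup.isClosed_of_isOpen W hW
  rw [← shapiroOpenAddEquiv_coindOpenHRep_two, (QuotientGroup.eq_one_iff w).2 hw, map_one,
    Module.End.one_apply]

end Shapiro

end ContinuousRep

end Literature.NumberTheory.GaloisRepresentations

end
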